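import Mathlib
import HarnessLib
import Summits.HubbardSuperconductivity.HubbardSuperconductivity.Theorems.KLProgrammeKLRegimeSplitSlotsV17FMono
import Summits.HubbardSuperconductivity.HubbardSuperconductivity.Theorems.KLProgrammeKLRegimeEngineV8DefsG11Hosting

/-!
# K3 ENGINE package, `G`-level v14 — CANDIDATE for the post-FREEZE «AMENDMENT 25 — (X).3-KLTS-CAP» folded into AMENDMENT 24 (plan g23 (R257), 2026-08-28):
# `klEngGeo14 := (klEngGeo13.addShellLog (2⁵²·klTS)).raiseCF (2⁸⁰·klTS)` and the CAP-GENERIC hosting of a pinned relative bar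
# (cell gate-hubbard-kl, seat hubbard-kl-k3c2-p2 g20; NO token role until the pen says so)

WHY.  (R257) decides «(X).3-KLTS-NUMERIC» by a TEXT move, preferred shape (a): the class-#5 prefactor cap becomes `klTS`-keyed, `r ≤ klCTcap7·(1 + klTS) = 2²⁰(1 + klTS)`.
The engine token must then host a relative bar with that larger prefactor.  The hosting numerals of record (`klCTcap7_ph_share : 8·2²⁰·15367 ≤ 2⁻¹⁵·2⁵²`,
`klCTcap7_thermal_weight : 2·2²⁰·15367·2⁴⁰ ≤ 2⁷⁵` against `CF ≥ 2⁸⁰`; `transferBarRelIdx_klCT7_le_slots`) need, at the cap `2²⁰(1+klTS)`, a PH shell-log coefficient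
`≥ 2⁵²(1+klTS)` and `CF ≥ 2⁸⁰(1+klTS)`.  `klEngGeo13 = (klEngGeo11.scaleGains 2).addShellLogPP klXSA` carries the ph coefficient `2·2⁵²` (`klEngGeo11 = G₁₀′.addShellLog 2⁵²`)
and `CF ≥ 2⁸¹`: room for `2·klCTcap7` only.  Hence
* §1 **`klEngGeo14 := (klEngGeo13.addShellLog (2⁵²·klTS)).raiseCF (2⁸⁰·klTS)`** — ONE extra ph shell-log addend `2⁵²klTS·(klRelGain n (ρ⊔0) + 2⁻ⁿ)` and ONE
  CF raise `2⁸⁰klTS` (+ the addend's `7·2⁵²klTS`); `ppGain`, `cE4`, `S`, `SL`, `Bf`, `bhi`, `blo`, `aplus`, `ζ`, `Z`, `cloc`, `θ`, `a`, `atop`, `abot` untouched; `klEngGeo14_wf`;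
  the two hosting facts **`klEngGeo14_phGain_ge`** (`2⁵²(2 + klTS)·(klRelGain n ρ + 2⁻ⁿ) ≤ klEngGeo14.phGain n ρ`, `0 ≤ ρ`) and **`two_pow_80_mul_le_klEngGeo14_CF`**
  (`2⁸⁰·(2 + klTS) ≤ klEngGeo14.CF`); **`slotLE_klEngGeo13_klEngGeo14`** / `slotLE_klEngGeo11_klEngGeo14` (so every V17F conjunct lifts names-only by p656350's kit).
* §2 **`transferBarRelIdx_pinned_le_slots_of_cap`** — the CAP-GENERIC hosting: for ANY `0 ≤ r ≤ cap` and any engine package `G` with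
  `Cph·(klRelGain (n+1) ρ + 2^{−(n+1)}) ≤ G.phGain (n+1) ρ` (`0 ≤ ρ`), `8·cap·15367 ≤ sph·Cph`, `2·cap·15367·Gth.CF ≤ sth·G.CF` (`0 < Cph`, `0 < G.CF`):
  `transferBarRelIdx L Gth P r β U n n ≤ sph·(KlamU)²(G.phGain (n+1) ρ_d + G.phGain (n+1) ρ_x) + 2r·15367(KlamU)²/L + 4r·15367(Klam|U|)³2^{−(n+1)} + sth·thermalBar G (n+1)`
  (field-inequality form of p1's `transferBarRelIdx_pinned_le_slots`, no record equation needed); instance **`transferBarRelIdx_le_slots_klEngGeo14_of_cap`**: any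
  `r ≤ 2²⁰·(1 + klTS)` at `Gth = klEngGeoTh` hosts in `klEngGeo14` with the shares of record `(2⁻¹⁵, 2⁻⁵)`; **`relBar_le_bars_klEngGeo14_of_cap`** (gainBar form, the `hTb` binder).
TEXT-NEUTRAL: no package of record moves; `klCTcap7`/`IsTransferPkg7` are untouched (the cap's re-keying is the pen's AMENDMENT 25).  Definitions with bodies +
order lemmas + pure real arithmetic; nothing about the model is asserted; nothing asserts (X).3, (E2″-F), (c), K3 or superconductivity.  0 kit · 0 lit.
-/

noncomputable section

namespace Summit.HubbardSuperconductivity.HubbardSuperconductivity.Theorems.EngineV8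

set_option linter.dupNamespace false -- summit = problem name (single-conjunct summit), D-0017

open Real Finset Literature.MathematicalPhysics.QuantumLattice Literature.Probability.LatticeModels
open Summit.HubbardSuperconductivity.HubbardSuperconductivity.Theorems.KLRegimeSplit
open Summit.HubbardSuperconductivity.HubbardSuperconductivity.Theorems.KLProgrammeLegKernels
open Summit.HubbardSuperconductivity.HubbardSuperconductivity.Theorems.DispersionFlow

/-! ## §1 The candidate `klEngGeo14` -/

/-- **`klEngGeo14` — the engine-flow package's absolute constants `G`, v14 (AMENDMENT 24+25 candidate, `klTS`-keyed cap)**: `klEngGeo13` with one extra particle–hole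
shell-log addend of coefficient `2⁵²·klTS` and the freezing constant raised by `2⁸⁰·klTS`; nothing else moved. -/
def klEngGeo14 : GeoConsts := (klEngGeo13.addShellLog (2 ^ 52 * klTS)).raiseCF (2 ^ 80 * klTS)

/-- `klEngGeo14 = (klEngGeo13.addShellLog (2⁵²·klTS)).raiseCF (2⁸⁰·klTS)` (`rfl`). -/
theorem klEngGeo14_eq : klEngGeo14 = (klEngGeo13.addShellLog (2 ^ 52 * klTS)).raiseCF (2 ^ 80 * klTS) := rfl

/-- **`klEngGeo14` is well formed.** -/
theorem klEngGeo14_wf : klEngGeo14.WF := by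
  have h := klTS_nonneg
  exact GeoConsts.raiseCF_wf (GeoConsts.addShellLog_wf klEngGeo13_wf (by positivity)) (by positivity)

/-- the ph gain: `klEngGeo14.phGain n ρ = klEngGeo13.phGain n ρ + 2⁵²·klTS·(klRelGain n (ρ⊔0) + 2⁻ⁿ)`. -/
theorem klEngGeo14_phGain (n : ℕ) (ρ : ℝ) :
    klEngGeo14.phGain n ρ = klEngGeo13.phGain n ρ + 2 ^ 52 * klTS * (klRelGain n (max ρ 0) + ((2 : ℝ) ^ n)⁻¹) := rfl

/-- the pp gain is `klEngGeo13`'s. -/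
theorem klEngGeo14_ppGain : klEngGeo14.ppGain = klEngGeo13.ppGain := rfl

/-- the freezing constant: `klEngGeo14.CF = klEngGeo13.CF + 7·(2⁵²·klTS) + 2⁸⁰·klTS`. -/
theorem klEngGeo14_CF : klEngGeo14.CF = klEngGeo13.CF + 7 * (2 ^ 52 * klTS) + 2 ^ 80 * klTS := rfl

/-- `klEngGeo13.CF ≤ klEngGeo14.CF`. -/
theorem klEngGeo13_CF_le_klEngGeo14_CF : klEngGeo13.CF ≤ klEngGeo14.CF := by
  rw [klEngGeo14_CF]; have := klTS_nonneg; nlinarith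

/-- `0 ≤ klEngGeo14.CF`. -/
theorem klEngGeo14_CF_nonneg : 0 ≤ klEngGeo14.CF := klEngGeo13_CF_nonneg.trans klEngGeo13_CF_le_klEngGeo14_CF

/-- the gains grow: ph. -/
theorem klEngGeo13_phGain_le_klEngGeo14_phGain (n : ℕ) (ρ : ℝ) : klEngGeo13.phGain n ρ ≤ klEngGeo14.phGain n ρ := by
  rw [klEngGeo14_phGain]
  have := klRelGain_nonneg n (le_max_right ρ 0)
  have := klTS_nonneg
  have : 0 ≤ 2 ^ 52 * klTS * (klRelGain n (max ρ 0) + ((2 : ℝ) ^ n)⁻¹) := by positivity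
  linarith

/-- the gains grow: pp (equality). -/
theorem klEngGeo13_ppGain_le_klEngGeo14_ppGain (n : ℕ) (ρ : ℝ) : klEngGeo13.ppGain n ρ ≤ klEngGeo14.ppGain n ρ := by
  rw [klEngGeo14_ppGain]

/-- `0 ≤ klEngGeo14.phGain n ρ`. -/
theorem klEngGeo14_phGain_nonneg (n : ℕ) (ρ : ℝ) : 0 ≤ klEngGeo14.phGain n ρ :=
  (le_trans (klEngGeo11_phGain_nonneg n ρ) (klEngGeo11_phGain_le_klEngGeo13_phGain n ρ)).trans (klEngGeo13_phGain_le_klEngGeo14_phGain n ρ)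

/-- untouched field `cE4`. -/
theorem klEngGeo14_cE4 : klEngGeo14.cE4 = klEngGeo13.cE4 := rfl
/-- `klE4TF ≤ klEngGeo14.cE4` (rides). -/
theorem klE4TF_le_klEngGeo14_cE4 : klE4TF ≤ klEngGeo14.cE4 := klE4TF_le_klEngGeo13_cE4
/-- `klE4T6 ≤ klEngGeo14.cE4` (rides). -/
theorem klE4T6_le_klEngGeo14_cE4 : klE4T6 ≤ klEngGeo14.cE4 := klE4T6_le_klEngGeo13_cE4
/-- `klE4T ≤ klEngGeo14.cE4` (rides). -/
theorem klE4T_le_klEngGeo14_cE4 : klE4T ≤ klEngGeo14.cE4 := klE4T_le_klEngGeo13_cE4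
/-- untouched field `S`. -/
theorem klEngGeo14_S : klEngGeo14.S = klEngGeo13.S := rfl
/-- `klS6 j ≤ klEngGeo14.S j` (rides). -/
theorem klS6_le_klEngGeo14_S (j : ℕ) : klS6 j ≤ klEngGeo14.S j := klS6_le_klEngGeo13_S j
/-- untouched field `SL`. -/
theorem klEngGeo14_SL : klEngGeo14.SL = klEngGeo13.SL := rfl
/-- untouched field `Bf`. -/
theorem klEngGeo14_Bf : klEngGeo14.Bf = klEngGeo13.Bf := rfl
/-- untouched field `bhi`. -/
theorem klEngGeo14_bhi : klEngGeo14.bhi = klEngGeo13.bhi := rfl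
/-- untouched field `blo`. -/
theorem klEngGeo14_blo : klEngGeo14.blo = klEngGeo13.blo := rfl
/-- untouched field `aplus`. -/
theorem klEngGeo14_aplus : klEngGeo14.aplus = klEngGeo13.aplus := rfl
/-- untouched field `ζ`. -/
theorem klEngGeo14_ζ : klEngGeo14.ζ = klEngGeo13.ζ := rfl
/-- untouched field `Z`. -/
theorem klEngGeo14_Z : klEngGeo14.Z = klEngGeo13.Z := rfl
/-- untouched field `cloc`. -/
theorem klEngGeo14_cloc : klEngGeo14.cloc = klEngGeo13.cloc := rfl
/-- untouched field `θ`. -/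
theorem klEngGeo14_θ : klEngGeo14.θ = klEngGeo13.θ := rfl
/-- untouched field `a`. -/
theorem klEngGeo14_a : klEngGeo14.a = klEngGeo13.a := rfl
/-- untouched field `atop`. -/
theorem klEngGeo14_atop : klEngGeo14.atop = klEngGeo13.atop := rfl
/-- untouched field `abot`. -/
theorem klEngGeo14_abot : klEngGeo14.abot = klEngGeo13.abot := rfl

/-- `klIsoT⁴ ≤ klEngGeo14.CF` (rides). -/
theorem klIsoT_pow_four_le_klEngGeo14_CF : klIsoT ^ 4 ≤ klEngGeo14.CF := klIsoT_pow_four_le_klEngGeo13_CF.trans klEngGeo13_CF_le_klEngGeo14_CF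

/-- **`SlotLE klEngGeo13 klEngGeo14`**: gains and `CF` grow, the seven frozen fields agree — every V17F conjunct lifts `13 ↦ 14` by the `…_mono` rows of …SlotsV17FMono. -/
theorem slotLE_klEngGeo13_klEngGeo14 : GeoConsts.SlotLE klEngGeo13 klEngGeo14 where
  ppGain_le := klEngGeo13_ppGain_le_klEngGeo14_ppGain
  phGain_le := klEngGeo13_phGain_le_klEngGeo14_phGain
  CF_le := klEngGeo13_CF_le_klEngGeo14_CF
  bhi_eq := klEngGeo14_bhi
  cloc_eq := klEngGeo14_cloc
  θ_eq := klEngGeo14_θ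
  aplus_eq := klEngGeo14_aplus
  ζ_eq := klEngGeo14_ζ
  atop_eq := klEngGeo14_atop
  abot_eq := klEngGeo14_abot

/-- `SlotLE klEngGeo11 klEngGeo14` (through `klEngGeo13`). -/
theorem slotLE_klEngGeo11_klEngGeo14 : GeoConsts.SlotLE klEngGeo11 klEngGeo14 where
  ppGain_le n ρ := (slotLE_klEngGeo11_klEngGeo13.ppGain_le n ρ).trans (slotLE_klEngGeo13_klEngGeo14.ppGain_le n ρ)
  phGain_le n ρ := (slotLE_klEngGeo11_klEngGeo13.phGain_le n ρ).trans (slotLE_klEngGeo13_klEngGeo14.phGain_le n ρ)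
  CF_le := slotLE_klEngGeo11_klEngGeo13.CF_le.trans slotLE_klEngGeo13_klEngGeo14.CF_le
  bhi_eq := by rw [klEngGeo14_bhi, klEngGeo13_bhi]
  cloc_eq := by rw [klEngGeo14_cloc, klEngGeo13_cloc]
  θ_eq := by rw [klEngGeo14_θ, klEngGeo13_θ]
  aplus_eq := by rw [klEngGeo14_aplus, klEngGeo13_aplus]
  ζ_eq := by rw [klEngGeo14_ζ, klEngGeo13_ζ]
  atop_eq := by rw [klEngGeo14_atop, klEngGeo13_atop]
  abot_eq := by rw [klEngGeo14_abot, klEngGeo13_abot]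

/-! ### The two hosting facts of the candidate -/

/-- The ph shell-log content of `klEngGeo11`: `2⁵²·(klRelGain n ρ + 2⁻ⁿ) ≤ klEngGeo11.phGain n ρ` for `0 ≤ ρ` (`klEngGeo11 = G₁₀′.addShellLog 2⁵²`, `0 ≤ G₁₀′.phGain`). -/
theorem klEngGeo11_phGain_ge (n : ℕ) {ρ : ℝ} (hρ : 0 ≤ ρ) : 2 ^ 52 * (klRelGain n ρ + ((2 : ℝ) ^ n)⁻¹) ≤ klEngGeo11.phGain n ρ := by
  rw [klEngGeo11_eq_addShellLog, GeoConsts.addShellLog_phGain, max_eq_left hρ]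
  linarith [klEngGeo8_raiseCF_addTwoShell_phGain_nonneg n ρ]

/-- **HOSTING FACT (ph)**: `2⁵²·(2 + klTS)·(klRelGain n ρ + 2⁻ⁿ) ≤ klEngGeo14.phGain n ρ` for `0 ≤ ρ` — room for the cap `2²⁰(1 + klTS)` at the ph share `2⁻¹⁵`
(`8·2²⁰(1+klTS)·15367 ≤ 2⁻¹⁵·2⁵²(2+klTS)`). -/
theorem klEngGeo14_phGain_ge (n : ℕ) {ρ : ℝ} (hρ : 0 ≤ ρ) : 2 ^ 52 * (2 + klTS) * (klRelGain n ρ + ((2 : ℝ) ^ n)⁻¹) ≤ klEngGeo14.phGain n ρ := by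
  rw [klEngGeo14_phGain, klEngGeo13_phGain, max_eq_left hρ]
  have h11 := klEngGeo11_phGain_ge n hρ
  linarith

/-- **HOSTING FACT (thermal)**: `2⁸⁰·(2 + klTS) ≤ klEngGeo14.CF` — room for the cap `2²⁰(1 + klTS)` at the thermal share `2⁻⁵` (`2·2²⁰(1+klTS)·15367·2⁴⁰ ≤ 2⁻⁵·2⁸⁰(2+klTS)`). -/
theorem two_pow_80_mul_le_klEngGeo14_CF : 2 ^ 80 * (2 + klTS) ≤ klEngGeo14.CF := by
  rw [klEngGeo14_CF]
  have h13 : 2 * klEngGeo11.CF ≤ klEngGeo13.CF := two_mul_klEngGeo11_CF_le_klEngGeo13_CF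
  have h11 : (2 : ℝ) ^ 80 ≤ klEngGeo11.CF := two_pow_eighty_le_klEngGeo11_CF
  have hT := klTS_nonneg
  nlinarith

/-- `2⁸⁰ ≤ klEngGeo14.CF` (in particular). -/
theorem two_pow_eighty_le_klEngGeo14_CF : (2 : ℝ) ^ 80 ≤ klEngGeo14.CF := by
  have := two_pow_80_mul_le_klEngGeo14_CF; have := klTS_nonneg; nlinarith

/-! ## §2 The cap-generic hosting of a pinned relative bar -/

variable {L : ℕ}

/-- **CAP-GENERIC HOSTING (field-inequality form of `transferBarRelIdx_pinned_le_slots`).**  For `0 ≤ r ≤ cap`, an engine package `G` with ph shell-log content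
`Cph·(klRelGain (n+1) ρ + 2^{−(n+1)}) ≤ G.phGain (n+1) ρ` (`0 ≤ ρ`, `0 < Cph`), `0 < G.CF`, a thermal package `Gth` (`0 ≤ Gth.CF`), and shares with
`8·cap·15367 ≤ sph·Cph`, `2·cap·15367·Gth.CF ≤ sth·G.CF` (`0 ≤ P.Klam`):
`transferBarRelIdx L Gth P r β U n n Qm k k′ ≤ sph·(KlamU)²·(G.phGain (n+1) ρ_d + G.phGain (n+1) ρ_x) + 2r·15367·(KlamU)²/L + 4r·15367·(Klam|U|)³·2^{−(n+1)} + sth·thermalBar G (n+1)`. -/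
theorem transferBarRelIdx_pinned_le_slots_of_cap {G Gth : GeoConsts} (hGCF : 0 < G.CF) (hthCF : 0 ≤ Gth.CF) {Cph : ℝ} (hCph : 0 < Cph) (n : ℕ)
    (hph : ∀ ρ : ℝ, 0 ≤ ρ → Cph * (klRelGain (n + 1) ρ + ((2 : ℝ) ^ (n + 1))⁻¹) ≤ G.phGain (n + 1) ρ)
    {P : SplitConsts} (hKl : 0 ≤ P.Klam) {r cap sph sth : ℝ} (hr : 0 ≤ r) (hrc : r ≤ cap)
    (hsph : 8 * cap * 15367 ≤ sph * Cph) (hsth : 2 * cap * 15367 * Gth.CF ≤ sth * G.CF) (β U : ℝ) (Qm k k' : TorusSite 2 L) :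
    transferBarRelIdx L Gth P r β U n n Qm k k' ≤
      sph * ((P.Klam * U) ^ 2 * (G.phGain (n + 1) (klTorusNorm L (k - k')) + G.phGain (n + 1) (klTorusNorm L (k + k' - Qm)))) +
        2 * r * 15367 * ((P.Klam * U) ^ 2 * ((L : ℝ))⁻¹) + 4 * r * 15367 * ((P.Klam * |U|) ^ 3 * ((2 : ℝ) ^ (n + 1))⁻¹) +
        sth * thermalBar G P U β (n + 1) := by
  refine (transferBarRelIdx_pinned_le_succ_shapes (L := L) hthCF hKl hr β U n Qm k k').trans ?_
  set ρd := klTorusNorm L (k - k') with hρd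
  set ρx := klTorusNorm L (k + k' - Qm) with hρx
  have hρd0 : 0 ≤ ρd := by rw [hρd]; unfold klTorusNorm; exact torusSupNorm_nonneg _
  have hρx0 : 0 ≤ ρx := by rw [hρx]; unfold klTorusNorm; exact torusSupNorm_nonneg _
  set gd := klRelGain (n + 1) ρd + ((2 : ℝ) ^ (n + 1))⁻¹ with hgd
  set gx := klRelGain (n + 1) ρx + ((2 : ℝ) ^ (n + 1))⁻¹ with hgx
  have hgd0 : 0 ≤ gd := by rw [hgd]; have := klRelGain_nonneg (n + 1) hρd0; positivity
  have hgx0 : 0 ≤ gx := by rw [hgx]; have := klRelGain_nonneg (n + 1) hρx0; positivity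
  have hK : 0 ≤ (P.Klam * U) ^ 2 := sq_nonneg _
  have hK3 : 0 ≤ (P.Klam * |U|) ^ 3 := by have : 0 ≤ P.Klam * |U| := mul_nonneg hKl (abs_nonneg U); positivity
  have hcap0 : 0 ≤ cap := hr.trans hrc
  have hsph0 : 0 ≤ sph := by
    have h : 0 ≤ sph * Cph := le_trans (by positivity) hsph
    by_contra hneg; push Not at hneg
    have : sph * Cph < 0 := mul_neg_of_neg_of_pos hneg hCph
    linarith
  -- (ph) `2r·15367·K·4(gd + gx) ≤ sph·K·(ph ρd + ph ρx)`
  have hph1 : 2 * r * 15367 * ((P.Klam * U) ^ 2 * (4 * gd + 4 * gx)) ≤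
      sph * ((P.Klam * U) ^ 2 * (G.phGain (n + 1) ρd + G.phGain (n + 1) ρx)) := by
    have hd := hph ρd hρd0
    have hx := hph ρx hρx0
    rw [← hgd] at hd; rw [← hgx] at hx
    -- `8r·15367·(gd+gx) ≤ 8cap·15367·(gd+gx) ≤ sph·Cph·(gd+gx) ≤ sph·(ph ρd + ph ρx)`
    have h1 : 8 * r * 15367 * (gd + gx) ≤ sph * Cph * (gd + gx) := by
      have : 8 * r * 15367 ≤ 8 * cap * 15367 := by nlinarith
      exact mul_le_mul_of_nonneg_right (this.trans hsph) (by positivity)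
    have h2 : sph * Cph * (gd + gx) ≤ sph * (G.phGain (n + 1) ρd + G.phGain (n + 1) ρx) := by
      rw [mul_assoc]; exact mul_le_mul_of_nonneg_left (by nlinarith) hsph0
    have h3 := mul_le_mul_of_nonneg_left (h1.trans h2) hK
    have e1 : 2 * r * 15367 * ((P.Klam * U) ^ 2 * (4 * gd + 4 * gx)) = (P.Klam * U) ^ 2 * (8 * r * 15367 * (gd + gx)) := by ring
    have e2 : sph * ((P.Klam * U) ^ 2 * (G.phGain (n + 1) ρd + G.phGain (n + 1) ρx)) = (P.Klam * U) ^ 2 * (sph * (G.phGain (n + 1) ρd + G.phGain (n + 1) ρx)) := by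
      ring
    rw [e1, e2]; exact h3
  -- (thermal) `2r·15367·thermalBar Gth ≤ sth·thermalBar G`
  have hth1 : 2 * r * 15367 * thermalBar Gth P U β (n + 1) ≤ sth * thermalBar G P U β (n + 1) := by
    rw [thermalBar_eq_mul_thermalBar hGCF.ne' P U β (n + 1)]
    have hT0 : 0 ≤ thermalBar G P U β (n + 1) := thermalBar_nonneg' hGCF.le P U β (n + 1)
    have h1 : 2 * r * 15367 * (Gth.CF / G.CF) ≤ sth := by
      rw [show 2 * r * 15367 * (Gth.CF / G.CF) = (2 * r * 15367 * Gth.CF) / G.CF by ring, div_le_iff₀ hGCF]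
      have : 2 * r * 15367 * Gth.CF ≤ 2 * cap * 15367 * Gth.CF := by
        have := mul_le_mul_of_nonneg_right hrc hthCF; nlinarith
      exact this.trans hsth
    calc 2 * r * 15367 * (Gth.CF / G.CF * thermalBar G P U β (n + 1)) = (2 * r * 15367 * (Gth.CF / G.CF)) * thermalBar G P U β (n + 1) := by ring
      _ ≤ sth * thermalBar G P U β (n + 1) := mul_le_mul_of_nonneg_right h1 hT0
  -- assemble
  have e : 2 * r * 15367 * ((P.Klam * U) ^ 2 * (4 * gd + 4 * gx + ((L : ℝ))⁻¹) + 2 * ((P.Klam * |U|) ^ 3 * ((2 : ℝ) ^ (n + 1))⁻¹) + thermalBar Gth P U β (n + 1)) =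
      2 * r * 15367 * ((P.Klam * U) ^ 2 * (4 * gd + 4 * gx)) + 2 * r * 15367 * ((P.Klam * U) ^ 2 * ((L : ℝ))⁻¹) +
        4 * r * 15367 * ((P.Klam * |U|) ^ 3 * ((2 : ℝ) ^ (n + 1))⁻¹) + 2 * r * 15367 * thermalBar Gth P U β (n + 1) := by ring
  rw [e]
  linarith

/-- **THE CANDIDATE HOSTS THE `klTS`-KEYED CAP WITH THE SHARES OF RECORD**: for `Gth = klEngGeoTh` (`CF = 2⁴⁰`) and ANY `0 ≤ r ≤ 2²⁰·(1 + klTS)` (`0 ≤ P.Klam`):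
`transferBarRelIdx L klEngGeoTh P r β U n n Qm k k′ ≤ 2⁻¹⁵·(KlamU)²·(klEngGeo14.phGain (n+1) ρ_d + klEngGeo14.phGain (n+1) ρ_x) + 2r·15367·(KlamU)²/L +
4r·15367·(Klam|U|)³·2^{−(n+1)} + 2⁻⁵·thermalBar klEngGeo14 (n+1)` — the twin of `transferBarRelIdx_klCT7_le_slots_klEngGeo11` under AMENDMENT 25 shape (a). -/
theorem transferBarRelIdx_le_slots_klEngGeo14_of_cap {P : SplitConsts} (hKl : 0 ≤ P.Klam) {r : ℝ} (hr : 0 ≤ r) (hrc : r ≤ 2 ^ 20 * (1 + klTS))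
    (β U : ℝ) (n : ℕ) (Qm k k' : TorusSite 2 L) :
    transferBarRelIdx L klEngGeoTh P r β U n n Qm k k' ≤
      (2 : ℝ)⁻¹ ^ 15 * ((P.Klam * U) ^ 2 * (klEngGeo14.phGain (n + 1) (klTorusNorm L (k - k')) + klEngGeo14.phGain (n + 1) (klTorusNorm L (k + k' - Qm)))) +
        2 * r * 15367 * ((P.Klam * U) ^ 2 * ((L : ℝ))⁻¹) + 4 * r * 15367 * ((P.Klam * |U|) ^ 3 * ((2 : ℝ) ^ (n + 1))⁻¹) +
        (2 : ℝ)⁻¹ ^ 5 * thermalBar klEngGeo14 P U β (n + 1) := by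
  have hT := klTS_nonneg
  have hGCF : 0 < klEngGeo14.CF := lt_of_lt_of_le (by positivity) two_pow_eighty_le_klEngGeo14_CF
  have hCF := two_pow_80_mul_le_klEngGeo14_CF
  refine transferBarRelIdx_pinned_le_slots_of_cap (Cph := 2 ^ 52 * (2 + klTS)) hGCF klEngGeoTh_CF_nonneg (by positivity) n
    (fun ρ hρ => klEngGeo14_phGain_ge (n + 1) hρ) hKl hr hrc ?_ ?_ β U Qm k k'
  · -- `8·2²⁰(1+klTS)·15367 ≤ 2⁻¹⁵·2⁵²(2+klTS)`
    nlinarith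
  · -- `2·2²⁰(1+klTS)·15367·2⁴⁰ ≤ 2⁻⁵·klEngGeo14.CF`
    rw [klEngGeoTh_CF]
    nlinarith

/-- `0 ≤ klEngGeo14.ppGain n ρ`. -/
theorem klEngGeo14_ppGain_nonneg (n : ℕ) (ρ : ℝ) : 0 ≤ klEngGeo14.ppGain n ρ := by
  rw [klEngGeo14_ppGain]; exact (klEngGeo11_ppGain_nonneg n ρ).trans (klEngGeo11_ppGain_le_klEngGeo13_ppGain n ρ)

/-- **THE RELATIVE BAR BOOKS LIKE ONE STEP AT `klEngGeo14`, for ANY prefactor under the `klTS`-keyed cap** (twin of `relBar_klCT7_le_bars_klEngGeo11` — the `hTb` binder of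
`outClass_hout_klEngGeo13(_alpha/_of_raw)` after the lift `13 ↦ 14`): `0 ≤ r ≤ 2²⁰(1+klTS)` ⇒
`transferBarRelIdx L klEngGeoTh P r β U n n ≤ gainBar klEngGeo14 P U (n+1) ρpp ρd ρx + (2r·15367(KlamU)²/L + 4r·15367(Klam|U|)³2^{−(n+1)}) + thermalBar klEngGeo14 (n+1)`. -/
theorem relBar_le_bars_klEngGeo14_of_cap {P : SplitConsts} (hKl : 0 ≤ P.Klam) {r : ℝ} (hr : 0 ≤ r) (hrc : r ≤ 2 ^ 20 * (1 + klTS))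
    (β U : ℝ) (n : ℕ) (Qm k k' : TorusSite 2 L) :
    transferBarRelIdx L klEngGeoTh P r β U n n Qm k k' ≤
      gainBar klEngGeo14 P U (n + 1) (klTorusNorm L Qm) (klTorusNorm L (k - k')) (klTorusNorm L (k + k' - Qm)) +
        (2 * r * 15367 * ((P.Klam * U) ^ 2 * ((L : ℝ))⁻¹) + 4 * r * 15367 * ((P.Klam * |U|) ^ 3 * ((2 : ℝ) ^ (n + 1))⁻¹)) +
        thermalBar klEngGeo14 P U β (n + 1) := by
  have h := transferBarRelIdx_le_slots_klEngGeo14_of_cap (L := L) hKl hr hrc β U n Qm k k'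
  have hK : 0 ≤ (P.Klam * U) ^ 2 := sq_nonneg _
  have hpp := klEngGeo14_ppGain_nonneg (n + 1) (klTorusNorm L Qm)
  have hd := klEngGeo14_phGain_nonneg (n + 1) (klTorusNorm L (k - k'))
  have hx := klEngGeo14_phGain_nonneg (n + 1) (klTorusNorm L (k + k' - Qm))
  have hth : 0 ≤ thermalBar klEngGeo14 P U β (n + 1) := thermalBar_nonneg klEngGeo14_CF_nonneg P U β (n + 1)
  have hg : (2 : ℝ)⁻¹ ^ 15 * ((P.Klam * U) ^ 2 * (klEngGeo14.phGain (n + 1) (klTorusNorm L (k - k')) + klEngGeo14.phGain (n + 1) (klTorusNorm L (k + k' - Qm)))) ≤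
      gainBar klEngGeo14 P U (n + 1) (klTorusNorm L Qm) (klTorusNorm L (k - k')) (klTorusNorm L (k + k' - Qm)) := by
    unfold gainBar
    have hsum : 0 ≤ (P.Klam * U) ^ 2 * (klEngGeo14.phGain (n + 1) (klTorusNorm L (k - k')) + klEngGeo14.phGain (n + 1) (klTorusNorm L (k + k' - Qm))) :=
      by positivity
    nlinarith
  have ht : (2 : ℝ)⁻¹ ^ 5 * thermalBar klEngGeo14 P U β (n + 1) ≤ thermalBar klEngGeo14 P U β (n + 1) := by nlinarith
  linarith

end Summit.HubbardSuperconductivity.HubbardSuperconductivity.Theorems.EngineV8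

end
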